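import Mathlib
import Literature.Computability.Complexity.AdderBlocks
import Literature.Computability.MetaComplexity.GapMCSPLightConeLowerBound
import Literature.Computability.MetaComplexity.SearchMCSPLightConeLowerBound
import Literature.Computability.MetaComplexity.ChenJinWilliams2019.ZeroErrorMagnification
import Literature.Computability.MetaComplexity.OliveiraSanthanam2018.MCSPZeroErrorFormulaMagnification
import HarnessLib

/-!
# `MCSP[s]` is not zero-error solvable on average by very small general circuits
# (census rows R55 and R67, KNOWN column)

Topic `Computability/MetaComplexity`; a companion to `GapMCSPLightConeLowerBound.lean` (the
folklore light-cone / fibre-counting lower bound for sparse promise problems against `B₂`-circuits)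
for the **zero-error average-case** device model of Oliveira–Santhanam (FOCS 2018, preamble to Thm. 5,
p. 5: a device answering `0`, `1` or `?`, never incorrect, answering `?` on at most a `1/q` fraction of
the inputs; tree notions `OliveiraSanthanam2018.ZeroErrorSolvesFrac q v d g` /
`OliveiraSanthanam2018.ZESolvableFracAt q 𝒞 L n` — a pair (value function `v`, flag `d`) from the class
`𝒞`, `q · #{d = 0} ≤ 2ⁿ`; `q = 2` is FOCS'18 p. 5, `q = n` (input length) is Chen–Jin–Williams 2019's
`ChenJinWilliams2019.ZeroErrorSolves` / `ZESolvableAt`, §1.1.2 of ECCC TR19-118). Two magnification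
theorems have hypotheses in this model against GENERAL circuits of size far below the input length
`N = 2^m`:

* census row **R55** (`MagnificationGapCensus.gap_R55`; Chen–Jin–Williams 2019, Thm. 1.10, first
  bullet, `𝒞 = Circuit`, fact `ChenJinWilliams2019.thm110_MCSP_circuit`): for some `s(m) ≥ m`,
  `MCSP[s(m)]` at length `2^m` is not zero-error solvable (`q = N`) by pairs of `B₂`-circuits with
  `s(m)ᵏ + k` gates, for every `k` (`¬ ChenJinWilliams2019.MCSPZESolvableCircuit s`);
* census row **R67** (`MagnificationGapCensus.gap_R67`, part `MagnificationGapCensus/AverageCaseCircuits`;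
  Oliveira–Santhanam, ECCC TR18-139 Cor. 28, fact `OliveiraSanthanam2018.cor28`): for some `c ≥ 1` and
  `γ > 0`, `MCSP[m^c]` at length `N = 2^m` is not zero-error solvable with confidence `1/2` (`q = 2`) by
  pairs of `B₂`-circuits with `k⌈N^γ⌉ + k` gates, for every `k`
  (`¬ OliveiraSanthanam2018.MCSPPowZESolvableCircuit c γ`).

Both rows are recorded in the census as **T-ONLY**: no lower bound in the zero-error model is stated in
the sources or was found in print (Oliveira–Santhanam, FOCS 2018 p. 2, contrast their zero-error
hypothesis only with the WORST-CASE formula bound of Hirahara–Santhanam 2017). This file proves an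
unconditional (small) lower bound in exactly this model.

## What is proved here (all kernel-checked, no named facts used)

* `Literature.Computability.Complexity.cktSize_minterm`, `cktSize_anyMinterm`,
  `circuitSizeOver_memFinset_le`: **sparse functions have small circuits** — the indicator of a
  nonempty finite set `T` of points of `{0,1}^{k+1}` has a `B₂`-circuit with at most `|T|·(k+2) - 1`
  gates (one minterm of `k + 1` literals per point, `k + 1` gates each since every binary Boolean
  operation is a `B₂` gate, collected by a chain of OR gates; Jukna 2012, §1.1 — DNFs and
  minterms; his Claim 1.16, the simultaneous all-minterms bound, is NOT what is used here, referee
  W-A224-1).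
* `Literature.Computability.Complexity.two_pow_le_card_filter_agree`: a cylinder over a set `K` of
  coordinates of `{0,1}^ι` has `2^{|ι| - |K|}` points.
* `ChenJinWilliams2019.not_ZESolvableFracAt_MCSPSize_of_circuitCount_lt` (**single length, every
  confidence `1 - 1/q`, `q ≥ 2`**): if `m ≥ 1`, `(t + 1)(m + 1) ≤ s(m) + 1` and the number of `m`-variable
  functions of `B₂`-complexity `≤ s(m)` (at most `(s+1)(16(m+s+1)²)ˢ(m+s+1)`,
  `CircuitCount.card_computable_le'`) is below `2^{2^m - 2t - 2}`, then `MCSP[s]` is not zero-error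
  solved at length `2^m` by any pair of `B₂`-circuits with `≤ t` gates each. **Proof.** Let `(v, d)` be
  such a pair, computed by circuits `C_v, C_d` with light cones `S_v, S_d` (`|S_·| ≤ t + 1`,
  `Circuit.card_lightCone_le_size_succ`). Since `q ≥ 2` the flag is not identically `0`
  (`ZeroErrorSolvesFrac.exists_defined`): pick `x₀` with `d(x₀) = 1`. Let `z` be `x₀` on `S_d` and `0`
  elsewhere. Then `d(z) = d(x₀) = 1` (`Circuit.eval_congr_lightCone`), and `z` is the truth table of the
  indicator of at most `|S_d| ≤ t + 1` points of `{0,1}^m`, of circuit complexity `≤ (t+1)(m+1) - 1 ≤ s(m)`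
  by the first bullet, so `z ∈ MCSP[s]` and, the pair being correct where defined, `v(z) = 1`. Every
  input `x` agreeing with `z` on `S_v ∪ S_d` (at least `2^{2^m - 2t - 2}` of them) has `d(x) = 1` and
  `v(x) = v(z) = 1`, hence lies in `MCSP[s]`, i.e. tabulates a function of complexity `≤ s(m)` — more
  than there are. (Only `#{d = 0} < 2^N` is used, not the density bound.)
* `ChenJinWilliams2019.eventually_not_ZESolvableFracAt_MCSPSize` (**the KNOWN cells**): for every `q ≥ 2`
  and every size function in the regime of the rows and of the light-cone method
  (`ChenJinWilliams2019.SizeRegime s`: `s(m) ≥ m` and `s(m) ≤ 2^{cm}` eventually for some `c < 1`),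
  for all large `m`, `MCSP[s]` at length `2^m` is **not** zero-error solvable with confidence `1 - 1/q`
  by pairs of `B₂`-circuits with `s(m)/(m+1) - 1` gates each; `eventually_not_ZESolvableAt_MCSPSize` is
  the `q = N` (Chen–Jin–Williams) form and `eventually_not_ZESolvableFracAt_MCSPSize_pow` the row-R67
  form (`s(m) = m^c`, `q = 2`: known budget `m^c/(m+1) - 1 = Θ((log N)^{c-1})` gates versus NEEDED
  `k⌈N^γ⌉ + k` for every `k`). For R55 the NEEDED budget is `s(m)ᵏ + k` for EVERY `k`; the gap in this
  model is thus "degree `< 1` in `s(m)` (up to the factor `m + 1 = log N + 1`) versus every polynomial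
  degree", and at the smallest admissible parameter `s(m) = m` the known budget is `0` gates — the
  content of the hypothesis is in the flag, as the census row says.

The single-length theorem is stated for an arbitrary budget `t`, threshold `s(m)` and confidence `q`
so that census parts can instantiate other cells.
-/

namespace Literature.Computability.Complexity

open Finset

/-! ### Sparse Boolean functions have small `B₂`-circuits -/

/-- **A minterm costs one gate per literal over `B₂`.** For `a ∈ {0,1}^{k+1}` the point indicator
`[x = a]` has a `B₂`-circuit with `k + 1` gates: `[x = a] = [tail x = tail a] ∧ (x₀ ↔ a₀)`, and every
binary Boolean operation is a single `B₂` gate (`cktSize_bin`). (Jukna 2012, §1.1: minterms / DNFs;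
the one-gate-per-literal count is elementary; Claim 1.16 there — all minterms simultaneously — is a
different statement and is not used.) [cite: Jukna2012, §1.1 (minterms, DNFs)] -/
theorem cktSize_minterm : ∀ (k : ℕ) (a : Fin (k + 1) → Bool),
    CktSize B2 (fun (x : Fin (k + 1) → Bool) (_ : Unit) => decide (x = a)) (k + 1)
  | 0, a => (cktSize_bin (fun u _ => u == a 0) (0 : Fin 1) (0 : Fin 1)).congr fun x _ => by
      by_cases h : x = a
      · subst h
        simp
      · rw [decide_eq_false h]
        by_contra hne
        rw [Bool.eq_false_iff, ne_eq, not_not, beq_iff_eq] at hne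
        exact h (funext fun i => by rw [Subsingleton.elim i 0]; exact hne)
  | k + 1, a => by
    -- stage A: pass the inputs through and compute the minterm of the last `k + 1` variables
    have hA : CktSize B2 (fun (x : Fin (k + 2) → Bool) =>
        Sum.elim x (fun (_ : Unit) => decide ((fun i => x (Fin.succ i)) = fun i => a (Fin.succ i))))
        (0 + (k + 1)) :=
      (CktSize.id B2).pair ((cktSize_minterm k (fun i => a (Fin.succ i))).rewire Fin.succ)
    -- stage B: one more gate
    have hB : CktSize B2 (fun (w : Fin (k + 2) ⊕ Unit → Bool) (_ : Unit) =>
        (w (.inr ()) && (w (.inl 0) == a 0))) 1 :=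
      cktSize_bin (fun u v => u && (v == a 0)) _ _
    refine ((hA.comp hB).of_le (by omega)).congr fun x _ => ?_
    simp only [Sum.elim_inr, Sum.elim_inl]
    by_cases h : x = a
    · subst h
      simp
    · rw [decide_eq_false h]
      by_contra hne
      rw [Bool.eq_false_iff, ne_eq, not_not, Bool.and_eq_true, decide_eq_true_eq,
        beq_iff_eq] at hne
      apply h
      funext i
      refine Fin.cases hne.2 (fun j => ?_) i
      exact congrFun hne.1 j

/-- **The indicator of a nonempty list of points has a small circuit**: for points
`a, b₁, …, b_r ∈ {0,1}^{k+1}`, the function `x ↦ [x = a] ∨ [x = b₁] ∨ ⋯ ∨ [x = b_r]` has a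
`B₂`-circuit with `r(k + 2) + (k + 1)` gates (one minterm per point, `cktSize_minterm`, and `r` OR
gates). [cite: Jukna2012, §1.1 (DNFs)] -/
theorem cktSize_anyMinterm (k : ℕ) : ∀ (L : List (Fin (k + 1) → Bool)) (a : Fin (k + 1) → Bool),
    CktSize B2 (fun (x : Fin (k + 1) → Bool) (_ : Unit) => (a :: L).any fun b => decide (x = b))
      (L.length * (k + 2) + (k + 1))
  | [], a => ((cktSize_minterm k a).congr fun x _ => by simp).of_le (by simp)
  | b :: L, a => by
    have hA : CktSize B2 (fun (x : Fin (k + 1) → Bool) =>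
        Sum.elim (fun (_ : Unit) => (b :: L).any fun c => decide (x = c))
          (fun (_ : Unit) => decide (x = a)))
        ((L.length * (k + 2) + (k + 1)) + (k + 1)) :=
      (cktSize_anyMinterm k L b).pair (cktSize_minterm k a)
    have hB : CktSize B2 (fun (w : Unit ⊕ Unit → Bool) (_ : Unit) => (w (.inr ()) || w (.inl ())))
        1 :=
      cktSize_bin (fun u v => u || v) _ _
    refine ((hA.comp hB).of_le (le_of_eq ?_)).congr fun x _ => ?_
    · simp only [List.length_cons]
      ring
    · simp only [Sum.elim_inr, Sum.elim_inl, List.any_cons]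

/-- **Sparse functions have small circuits.** The indicator of a nonempty finite set `T` of points
of `{0,1}^{k+1}` has `B₂`-circuit complexity `≤ |T|(k + 2) - 1` (so `+ 1 ≤ |T|(k+2)`).
[cite: Jukna2012, §1.1 (DNFs)] -/
theorem circuitSizeOver_memFinset_le {k : ℕ} (T : Finset (Fin (k + 1) → Bool)) (hT : T.Nonempty) :
    circuitSizeOver B2 (fun x => decide (x ∈ T)) + 1 ≤ T.card * (k + 2) := by
  classical
  obtain ⟨a, L, haL⟩ : ∃ (a : Fin (k + 1) → Bool) (L : List (Fin (k + 1) → Bool)),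
      T.toList = a :: L := by
    cases hl : T.toList with
    | nil =>
      exact absurd (Finset.toList_eq_nil.1 hl) hT.ne_empty
    | cons a L => exact ⟨a, L, rfl⟩
  have hlen : L.length + 1 = T.card := by
    have := congrArg List.length haL
    rw [Finset.length_toList, List.length_cons] at this
    omega
  obtain ⟨C, hC, hsz, hev⟩ := (cktSize_anyMinterm k L a).toCircuit
  have hcomp : C.Computes fun x => decide (x ∈ T) := by
    intro x
    rw [hev x, ← haL, Bool.eq_iff_iff, List.any_eq_true]
    simp only [decide_eq_true_eq, Finset.mem_toList]
    constructor
    · rintro ⟨b, hb, rfl⟩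
      exact hb
    · intro hx
      exact ⟨x, hx, rfl⟩
  have h1 := circuitSizeOver_le_of_computes C hC hcomp
  have h2 : L.length * (k + 2) + (k + 1) + 1 = T.card * (k + 2) := by
    rw [← hlen]
    ring
  omega

/-- The constant function `0` has `B₂`-circuit complexity `≤ 1`. [folklore] -/
theorem circuitSizeOver_const_false_le (ι : Type*) :
    circuitSizeOver B2 (fun (_ : ι → Bool) => false) ≤ 1 := by
  obtain ⟨C, hC, hsz, hev⟩ := (cktSize_const ι false).toCircuit
  exact (circuitSizeOver_le_of_computes C hC fun x => hev x).trans hsz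

/-! ### Cylinders -/

/-- **A cylinder over `|K|` coordinates of `{0,1}^ι` has `2^{|ι| - |K|}` points**: at least that
many `x` agree with a fixed `z` on `K`. [folklore] -/
theorem two_pow_le_card_filter_agree {ι : Type*} [Fintype ι] [DecidableEq ι] (K : Finset ι)
    (z : ι → Bool) :
    2 ^ (Fintype.card ι - K.card) ≤ #{x : ι → Bool | ∀ i ∈ K, x i = z i} := by
  classical
  -- extend an assignment of the variables outside `K` by `z` inside it
  let ψ : (↥(Kᶜ) → Bool) → (ι → Bool) := fun u i =>
    if h : i ∈ K then z i else u ⟨i, mem_compl.2 h⟩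
  have hψinj : Function.Injective ψ := by
    intro u u' huu'
    funext j
    have hj : (j : ι) ∉ K := mem_compl.1 j.2
    have := congrFun huu' j
    simpa [ψ, hj] using this
  have hψmem : ∀ u, ψ u ∈ (univ.filter fun x : ι → Bool => ∀ i ∈ K, x i = z i) := by
    intro u
    simp only [mem_filter, mem_univ, true_and]
    intro i hi
    simp [ψ, hi]
  calc 2 ^ (Fintype.card ι - K.card)
      = Fintype.card (↥(Kᶜ) → Bool) := by
        rw [Fintype.card_fun, Fintype.card_bool, Fintype.card_coe, card_compl]
    _ = (univ.image ψ).card := by rw [card_image_of_injective _ hψinj, card_univ]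
    _ ≤ #{x : ι → Bool | ∀ i ∈ K, x i = z i} :=
        card_le_card fun x hx => by
          obtain ⟨u, -, rfl⟩ := mem_image.1 hx
          exact hψmem u

end Literature.Computability.Complexity

namespace Literature.Computability.MetaComplexity.ChenJinWilliams2019

open Finset Filter Topology Literature.Computability.Complexity
open Literature.Computability.MetaComplexity Literature.Computability.MetaComplexity.ChenJinWilliams2020

/-! ### Single length: a zero-error pair of small circuits for `MCSP[s]` does not exist -/

/-- **Zero-error `MCSP[s]` (any confidence `1 - 1/q`, `q ≥ 2`) needs more than `t` gates** whenever
`m ≥ 1`, `(t+1)(m+1) ≤ s(m) + 1` (every pattern on `t + 1` positions of a truth table extends to a YES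
instance) and the circuit count at threshold `s(m)` is below `2^{2^m - 2t - 2}` (the joint light-cone
fibre of the pair). See the module docstring for the proof. [folklore] -/
theorem not_ZESolvableFracAt_MCSPSize_of_circuitCount_lt {q : ℕ} (hq : 2 ≤ q) {s t : ℕ → ℕ}
    {m : ℕ} (hm : 1 ≤ m) (ht : (t (2 ^ m) + 1) * (m + 1) ≤ s m + 1)
    (hcount : (s m + 1) * (16 * (m + s m + 1) ^ 2) ^ s m * (m + s m + 1) <
      2 ^ (2 ^ m - 2 * t (2 ^ m) - 2)) :
    ¬ OliveiraSanthanam2018.ZESolvableFracAt q (b2CircuitFns t) (MCSPSize s) (2 ^ m) := by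
  -- `m = k + 1`
  obtain ⟨k, rfl⟩ : ∃ k, m = k + 1 := ⟨m - 1, by omega⟩
  rintro ⟨v, ⟨Cv, ⟨hBv, hszv⟩, hcv⟩, d, ⟨Cd, ⟨hBd, hszd⟩, hcd⟩, hze⟩
  -- the function tabulated by an input of length `2^m`
  let e := boolFunEquivFin (k + 1)
  let tbl : (Fin (2 ^ (k + 1)) → Bool) → ((Fin (k + 1) → Bool) → Bool) := fun x w => x (e w)
  have htbl_inj : Function.Injective tbl := by
    intro x x' h
    funext i
    have := congrFun h (e.symm i)
    simpa [tbl, e] using this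
  have htbl_tt : ∀ x, truthTable (tbl x) = List.ofFn x := by
    intro x
    simp [truthTable, tbl, e]
  have hslice : ∀ x : Fin (2 ^ (k + 1)) → Bool,
      sliceFn (MCSPSize s) (2 ^ (k + 1)) x = true ↔ circuitSizeOver B2 (tbl x) ≤ s (k + 1) := by
    intro x
    rw [← truthTable_mem_MCSPSize_iff, htbl_tt]
    exact (Set.mem_iff_boolIndicator _ _).symm
  -- a defined input `x₀`
  obtain ⟨x₀, hx₀⟩ := hze.exists_defined hq
  -- the YES instance `z`: `x₀` on the light cone of `C_d`, `0` elsewhere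
  let z : Fin (2 ^ (k + 1)) → Bool := fun i => decide (i ∈ Cd.lightCone) && x₀ i
  have hz_agree : ∀ i ∈ Cd.lightCone, z i = x₀ i := by
    intro i hi
    simp [z, hi]
  have hdz : d z = true := by
    rw [← hcd z, Cd.eval_congr_lightCone (fun i hi => hz_agree i hi), hcd x₀, hx₀]
  -- `z` tabulates the indicator of `T`, at most `|lightCone C_d| ≤ t + 1` points
  let T : Finset (Fin (k + 1) → Bool) :=
    univ.filter fun w => e w ∈ Cd.lightCone ∧ x₀ (e w) = true
  have htblz : tbl z = fun w => decide (w ∈ T) := by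
    funext w
    simp [tbl, z, T]
  have hTcard : T.card ≤ t (2 ^ (k + 1)) + 1 := by
    have h1 : T.card ≤ Cd.lightCone.card :=
      card_le_card_of_injOn e (fun w hw => by
        simp only [T, coe_filter, Set.mem_setOf_eq, mem_univ, true_and] at hw
        exact hw.1) e.injective.injOn
    have h2 := Cd.card_lightCone_le_size_succ hBd
    omega
  have hzsmall : circuitSizeOver B2 (tbl z) ≤ s (k + 1) := by
    rw [htblz]
    rcases T.eq_empty_or_nonempty with hT | hT
    · have hconst : (fun w : Fin (k + 1) → Bool => decide (w ∈ T)) = fun _ => false := by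
        funext w
        simp [hT]
      rw [hconst]
      have h0 := circuitSizeOver_const_false_le (Fin (k + 1))
      have hs1 : k + 1 + 1 ≤ s (k + 1) + 1 :=
        le_trans (Nat.le_mul_of_pos_left (k + 1 + 1) (Nat.succ_pos _)) ht
      omega
    · have h1 := circuitSizeOver_memFinset_le T hT
      have h3 : T.card * (k + 2) ≤ (t (2 ^ (k + 1)) + 1) * (k + 1 + 1) :=
        Nat.mul_le_mul hTcard le_rfl
      omega
  have hvz : v z = true := by
    rw [hze.correct hdz]
    exact (hslice z).2 hzsmall
  -- the joint fibre over `K = lightCone C_v ∪ lightCone C_d`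
  let K : Finset (Fin (2 ^ (k + 1))) := Cv.lightCone ∪ Cd.lightCone
  have hK : K.card ≤ 2 * t (2 ^ (k + 1)) + 2 := by
    calc K.card ≤ Cv.lightCone.card + Cd.lightCone.card := card_union_le _ _
      _ ≤ (Cv.size + 1) + (Cd.size + 1) :=
          Nat.add_le_add (Cv.card_lightCone_le_size_succ hBv) (Cd.card_lightCone_le_size_succ hBd)
      _ ≤ 2 * t (2 ^ (k + 1)) + 2 := by omega
  have hfib : ∀ x : Fin (2 ^ (k + 1)) → Bool, (∀ i ∈ K, x i = z i) →
      circuitSizeOver B2 (tbl x) ≤ s (k + 1) := by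
    intro x hx
    have hdx : d x = true := by
      rw [← hcd x, Cd.eval_congr_lightCone (fun i hi => hx i (mem_union_right _ hi)), hcd z, hdz]
    have hvx : v x = v z := by
      rw [← hcv x, ← hcv z]
      exact Cv.eval_congr_lightCone fun i hi => hx i (mem_union_left _ hi)
    have hx1 : sliceFn (MCSPSize s) (2 ^ (k + 1)) x = true := by
      rw [← hze.correct hdx, hvx, hvz]
    exact (hslice x).1 hx1
  have key : 2 ^ (2 ^ (k + 1) - 2 * t (2 ^ (k + 1)) - 2) ≤
      (s (k + 1) + 1) * (16 * ((k + 1) + s (k + 1) + 1) ^ 2) ^ s (k + 1) *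
        ((k + 1) + s (k + 1) + 1) :=
    calc 2 ^ (2 ^ (k + 1) - 2 * t (2 ^ (k + 1)) - 2)
        ≤ 2 ^ (Fintype.card (Fin (2 ^ (k + 1))) - K.card) :=
          Nat.pow_le_pow_right (by norm_num) (by simp only [Fintype.card_fin]; omega)
      _ ≤ #{x : Fin (2 ^ (k + 1)) → Bool | ∀ i ∈ K, x i = z i} := by
          convert two_pow_le_card_filter_agree K z
      _ ≤ #{f : (Fin (k + 1) → Bool) → Bool | circuitSizeOver B2 f ≤ s (k + 1)} := by
          refine card_le_card_of_injOn tbl (fun x hx => ?_) htbl_inj.injOn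
          simp only [coe_filter, Set.mem_setOf_eq, mem_univ, true_and] at hx ⊢
          exact hfib x hx
      _ ≤ _ := card_filter_circuitSizeOver_le (k + 1) (s (k + 1))
  exact absurd key (not_le.2 hcount)

/-! ### Numerics and the KNOWN cell of row R55 -/

/-- For `0 < β' < 1`: eventually `3⌈N^{β'}⌉ + 1 ≤ N`. [folklore] -/
theorem eventually_three_mul_ceil_rpow_succ_le {β' : ℝ} (hβ'0 : 0 < β') (hβ'1 : β' < 1) :
    ∀ᶠ N : ℕ in atTop, 3 * ⌈(N : ℝ) ^ β'⌉₊ + 1 ≤ N := by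
  have htend : Tendsto (fun N : ℕ => (N : ℝ) ^ (1 - β')) atTop atTop :=
    (tendsto_rpow_atTop (by linarith)).comp tendsto_natCast_atTop_atTop
  filter_upwards [htend.eventually_ge_atTop 7, eventually_ge_atTop 1] with N h7 hN1
  have hN1' : (1 : ℝ) ≤ N := by exact_mod_cast hN1
  have hNpos : (0 : ℝ) < N := by linarith
  have hsplit : (N : ℝ) ^ β' * (N : ℝ) ^ (1 - β') = N := by
    rw [← Real.rpow_add hNpos]; norm_num
  have hone : (1 : ℝ) ≤ (N : ℝ) ^ β' := Real.one_le_rpow hN1' hβ'0.le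
  have hceil_lt : (⌈(N : ℝ) ^ β'⌉₊ : ℝ) < (N : ℝ) ^ β' + 1 := Nat.ceil_lt_add_one (by positivity)
  have h7' : 7 * (N : ℝ) ^ β' ≤ N := by
    have h7'' : (7 : ℝ) ≤ (N : ℝ) ^ (1 - β') := h7
    calc 7 * (N : ℝ) ^ β' ≤ (N : ℝ) ^ (1 - β') * (N : ℝ) ^ β' :=
          mul_le_mul_of_nonneg_right h7'' (by positivity)
      _ = N := by rw [mul_comm, hsplit]
  have hR : ((3 * ⌈(N : ℝ) ^ β'⌉₊ + 1 : ℕ) : ℝ) ≤ N := by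
    push_cast
    linarith
  exact_mod_cast hR

/-- **Rows R55 / R67, KNOWN column (proved): `MCSP[s]` is not zero-error solvable (confidence
`1 - 1/q`, any `q ≥ 2`) by pairs of `B₂`-circuits with `s(m)/(m+1) - 1` gates**, for all large `m`, for
every `s` in the size regime `m ≤ s(m) ≤ 2^{cm}` (`c < 1`; `SizeRegime`). [folklore] -/
theorem eventually_not_ZESolvableFracAt_MCSPSize {q : ℕ} (hq : 2 ≤ q) {s : ℕ → ℕ}
    (hs : SizeRegime s) :
    ∀ᶠ m : ℕ in atTop, ¬ OliveiraSanthanam2018.ZESolvableFracAt q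
      (b2CircuitFns fun _ => s m / (m + 1) - 1) (MCSPSize s) (2 ^ m) := by
  obtain ⟨β, hβ0, hβ1, hsβ⟩ := hs.exists_eventually_le_noBound
  obtain ⟨β', hββ', hβ'1⟩ : ∃ β' : ℝ, β < β' ∧ β' < 1 := ⟨(β + 1) / 2, by linarith, by linarith⟩
  have hβ'0 : 0 < β' := by linarith
  have hA := eventually_circuitCount_noBound_lt hβ0 hββ' hβ'1
  have hB : ∀ᶠ m : ℕ in atTop, 3 * ⌈((2 ^ m : ℕ) : ℝ) ^ β'⌉₊ + 1 ≤ 2 ^ m :=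
    (tendsto_pow_atTop_atTop_of_one_lt (one_lt_two : (1 : ℕ) < 2)).eventually
      (eventually_three_mul_ceil_rpow_succ_le hβ'0 hβ'1)
  filter_upwards [hA, hB, hsβ, eventually_ge_atTop 1] with m hAm hBm hsm hm1
  apply not_ZESolvableFracAt_MCSPSize_of_circuitCount_lt hq hm1
  · -- realizability budget: `(s/(m+1) - 1 + 1)(m + 1) ≤ s + 1`
    have hfloor : m ≤ s m := hs.1 m
    rcases Nat.eq_zero_or_pos (s m / (m + 1)) with h0 | hpos
    · rw [h0]
      omega
    · rw [Nat.sub_add_cancel hpos]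
      exact (Nat.div_mul_le_self (s m) (m + 1)).trans (Nat.le_succ _)
  · -- the count
    have hcast : (((2 ^ m : ℕ) : ℝ)) = (2 : ℝ) ^ (m : ℕ) := by push_cast; ring
    have hTpow : ((2 ^ m : ℕ) : ℝ) ^ β' = (2 : ℝ) ^ (β' * m) := by
      rw [hcast, ← Real.rpow_natCast (2 : ℝ) m, ← Real.rpow_mul (by norm_num)]
      congr 1; ring
    have hsT : s m ≤ ⌈((2 ^ m : ℕ) : ℝ) ^ β'⌉₊ := by
      refine hsm.trans ?_
      unfold OliveiraPichSanthanam2019.noBound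
      rw [hTpow]
      exact Nat.ceil_mono (Real.rpow_le_rpow_of_exponent_le (by norm_num)
        (mul_le_mul_of_nonneg_right hββ'.le (Nat.cast_nonneg m)))
    have ht_le : s m / (m + 1) - 1 ≤ s m := (Nat.sub_le _ _).trans (Nat.div_le_self _ _)
    generalize hT : ⌈((2 ^ m : ℕ) : ℝ) ^ β'⌉₊ = T at hAm hBm hsT
    generalize ht' : s m / (m + 1) - 1 = t at ht_le
    calc (s m + 1) * (16 * (m + s m + 1) ^ 2) ^ s m * (m + s m + 1)
        ≤ (OliveiraPichSanthanam2019.noBound β m + 1) *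
              (16 * (m + OliveiraPichSanthanam2019.noBound β m + 1) ^ 2) ^
                OliveiraPichSanthanam2019.noBound β m *
            (m + OliveiraPichSanthanam2019.noBound β m + 1) := circuitCount_mono m hsm
      _ < 2 ^ (2 ^ m - (2 ^ m - T) - 1) := hAm
      _ ≤ 2 ^ (2 ^ m - 2 * t - 2) := Nat.pow_le_pow_right (by norm_num) (by omega)

/-- **Row R55, KNOWN column** in Chen–Jin–Williams' own notion (`Pr[?] ≤ 1/N`,
`ChenJinWilliams2019.ZESolvableAt`): for every `s` in the size regime and all large `m`, `MCSP[s]` at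
length `2^m` is not zero-error solvable by pairs of `B₂`-circuits with `s(m)/(m+1) - 1` gates. NEEDED by
Thm. 1.10 (first bullet, `𝒞 = Circuit`): the same with `s(m)ᵏ + k` gates for every `k`
(`¬ MCSPZESolvableCircuit s`). [folklore] -/
theorem eventually_not_ZESolvableAt_MCSPSize {s : ℕ → ℕ} (hs : SizeRegime s) :
    ∀ᶠ m : ℕ in atTop,
      ¬ ZESolvableAt (b2CircuitFns fun _ => s m / (m + 1) - 1) (MCSPSize s) (2 ^ m) := by
  filter_upwards [eventually_not_ZESolvableFracAt_MCSPSize (le_refl 2) hs, eventually_ge_atTop 1]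
    with m hm hm1 hze
  refine hm (OliveiraSanthanam2018.ZESolvableFracAt.of_zeSolvableAt hze ?_)
  calc 2 = 2 ^ 1 := (pow_one 2).symm
    _ ≤ 2 ^ m := Nat.pow_le_pow_right (by norm_num) hm1

/-- `s(m) = m^c` (`c ≥ 1`) is in the size regime. [folklore] -/
theorem sizeRegime_pow (c : ℕ) (hc : 1 ≤ c) : SizeRegime fun m => m ^ c := by
  refine ⟨fun m => ?_, ?_⟩
  · calc m = m ^ 1 := (pow_one m).symm
      _ ≤ m ^ c := by
          rcases Nat.eq_zero_or_pos m with rfl | hm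
          · simp
          · exact Nat.pow_le_pow_right hm hc
  · refine ⟨1 / 2, by norm_num, ?_⟩
    -- `m^c ≤ 2^{m/2}` eventually: compare logarithms, `log m / m → 0`
    have hlo := (isLittleO_log_rpow_atTop (by norm_num : (0 : ℝ) < 1)).tendsto_div_nhds_zero
    have hev : ∀ᶠ x : ℝ in atTop, Real.log x / x ^ (1 : ℝ) < Real.log 2 / (2 * c) :=
      hlo.eventually (gt_mem_nhds (by positivity))
    filter_upwards [tendsto_natCast_atTop_atTop.eventually hev, eventually_ge_atTop 1] with m hm hm1
    have hm1' : (1 : ℝ) ≤ m := by exact_mod_cast hm1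
    have hmpos : (0 : ℝ) < m := by linarith
    rw [Real.rpow_one, div_lt_div_iff₀ hmpos (by positivity)] at hm
    have hlog : Real.log ((m : ℝ) ^ c) ≤ Real.log ((2 : ℝ) ^ ((1 / 2 : ℝ) * m)) := by
      rw [Real.log_pow, Real.log_rpow (by norm_num)]
      nlinarith [Real.log_nonneg hm1']
    have := (Real.log_le_log_iff (by positivity) (by positivity)).1 hlog
    exact_mod_cast this

/-- **Row R67, KNOWN column (proved)**: for every `c ≥ 1`, for all large `m`, `MCSP[m^c]` at length
`N = 2^m` is not zero-error solvable with confidence `1/2` (Oliveira–Santhanam's notion, `q = 2`) by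
pairs of `B₂`-circuits with `m^c/(m+1) - 1` gates (`= Θ((log N)^{c-1})`). NEEDED by ECCC TR18-139
Cor. 28 (`OliveiraSanthanam2018.MCSPPowZESolvableCircuit c γ` false for some `γ > 0`): the same with
`k⌈N^γ⌉ + k` gates for every `k`. The same statement with `ZESolvableAt` is the R55 cell at
`s(m) = m^c` (`eventually_not_ZESolvableAt_MCSPSize (sizeRegime_pow c hc)`). [folklore] -/
theorem eventually_not_ZESolvableFracAt_MCSPSize_pow (c : ℕ) (hc : 1 ≤ c) :
    ∀ᶠ m : ℕ in atTop, ¬ OliveiraSanthanam2018.ZESolvableFracAt 2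
      (b2CircuitFns fun _ => m ^ c / (m + 1) - 1) (MCSPSize fun m => m ^ c) (2 ^ m) :=
  eventually_not_ZESolvableFracAt_MCSPSize (le_refl 2) (sizeRegime_pow c hc)

end Literature.Computability.MetaComplexity.ChenJinWilliams2019
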